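import Literature.Computability.AlgebraicComplexity.ValiantReductionCellsIV
import Literature.Computability.QuantumComplexity.BosonReductionMachine
import Literature.Computability.Complexity.ToranWitness
import HarnessLib

/-!
# Valiant's reduction as a polynomial-time machine, V: the word of the `0/1` matrix, and the post-processing

Fifth machine file. The reduction function of Valiant's theorem in the row-major word format of
`per01PlainFn` (`PermanentBitsPPoly.lean`): on the code of a 3-CNF `ψ` with `m` clauses it writes
the `N²` bits of the `0/1` matrix `valiant01 ψ` (`N = 34m + (34m)² (15m+2)`), in row-major order.

* `ValiantFP.mkCtx x₀ = ⟨x₀, 1^{N(|x₀|)²}⟩` (the pad makes the count `N²` at most the context length);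
* `ValiantFP.cellF ⟨ctx, 1ᵗ⟩` — the bit at position `t`: `(X, Y) = (t / N, t mod N)` by `divModFn`,
  then `bitF` (part IV); `wordF = BosonFP.cmapF cntF cellF 1 ∘ mkCtx` concatenates the `N²` bits
  (`wordF_encode : wordF ⌜ψ⌝ = word ψ`, `word ψ = ccat (t ↦ [b01 (mz ψ) n q (t/N) (t mod N) = 1]) N²`);
* `ValiantFP.redF` — canonicalise the input (`KSATRed.canonCNFFn`), test "every clause has three
  literals" (`w3F`), and output `wordF` or the non-square word `00` (`redF_apply`); `redF ∈ FP`;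
* the post-processing `ValiantFP.postF ⟨x₀, a⟩ = bin ((val a mod (2^{15m} + 1)) / 2^{12m})` on valid
  codes, `ε` otherwise (`postF_apply`, `postF ∈ FP`): the arithmetic recovering `numSat ψ` from the
  oracle answer (`Valiant3CNFFlat.numSat_eq`).

## References

* L. G. Valiant, *The complexity of computing the permanent*, Theoret. Comput. Sci. 8 (1979)
  189–201, Thm. 1 (the reduction is polynomial-time), Lemma 3.3, Prop. 3.4.
* C. H. Papadimitriou, *Computational Complexity*, Addison-Wesley 1994, Thm. 18.3 (proof).
* S. Arora, B. Barak, *Computational Complexity: A Modern Approach*, CUP 2009, §1.3, §17.3.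
-/

noncomputable section

namespace Literature.Computability.AlgebraicComplexity

open _root_.Computability Literature.Computability.Complexity Brick HashBricks Plumb OracleCompose Polynomial
open Literature.Computability.QuantumComplexity.BosonFP (cmapF cmapF_apply cmapF_mem_FP)
open Literature.LinearAlgebra.Matrix Valiant3CNF KSATRed SharpSATVerif ToranCH

namespace ValiantFP

variable (ψ : CNF ℕ)

/-! ### Sizes -/

/-- The size of Valiant's `0/1` matrix of a 3-CNF with `m` clauses: `N = 34m + (34m)² (15m+2)`. [cite: Valiant1979, Thm. 1] -/
def Nsz (m : ℕ) : ℕ := 34 * m + 34 * m * (34 * m) * (15 * m + 2)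

/-- `N` as a polynomial. [folklore] -/
def sizePoly : Polynomial ℕ := 34 * X + 34 * X * (34 * X) * (15 * X + 2)

/-- `sizePoly` evaluates to `Nsz`. [folklore] -/
@[simp] theorem eval_sizePoly (m : ℕ) : sizePoly.eval m = Nsz m := by
  simp [sizePoly, Nsz]

/-- `Nsz` is monotone. [folklore] -/
theorem Nsz_mono {a b : ℕ} (h : a ≤ b) : Nsz a ≤ Nsz b := by
  unfold Nsz
  exact Nat.add_le_add (Nat.mul_le_mul_left _ h)
    (Nat.mul_le_mul (Nat.mul_le_mul (Nat.mul_le_mul_left _ h) (Nat.mul_le_mul_left _ h)) (by omega))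

/-- **The word of Valiant's `0/1` matrix**: its `N²` bits in row-major order. [cite: Valiant1979, Thm. 1] -/
def word : List Bool :=
  ccat (fun t => [decide (b01 (mz ψ) (34 * ψ.length) (15 * ψ.length) (t / Nsz ψ.length) (t % Nsz ψ.length) = 1)])
    (Nsz ψ.length * Nsz ψ.length)

/-! ### The context and the cell -/

/-- The context `⟨x₀, 1^{N(|x₀|)²}⟩`. [folklore] -/
def mkCtx : List Bool → List Bool := fanoutFn id (polyFn (sizePoly * sizePoly))

/-- `mkCtx ∈ FP`. [folklore] -/
theorem mkCtx_mem_FP : mkCtx ∈ FP := fanoutFn_mem_FP id_mem_FP (polyFn_mem_FP _)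

/-- Value of `mkCtx`. [folklore] -/
theorem mkCtx_apply (x₀ : List Bool) : mkCtx x₀ = boolPair x₀ (ones (Nsz x₀.length * Nsz x₀.length)) := by
  simp [mkCtx]

/-- `1^N` read off `z = ⟨⟨x₀, pad⟩, 1ᵗ⟩` (`x₀ = ⟨1ᵐ, …⟩`). [folklore] -/
def tN : List Bool → List Bool := polyFn sizePoly ∘ fstF ∘ fstF ∘ fstF

/-- **The cell**: the bit at position `t` of the word, on `⟨ctx, 1ᵗ⟩`. [cite: Valiant1979, Thm. 1] -/
def cellF : List Bool → List Bool := bitF ∘ fanoutFn (fstF ∘ fstF) (divModFn ∘ fanoutFn tN sndF)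

/-- `cellF ∈ FP`. [folklore] -/
theorem cellF_mem_FP : cellF ∈ FP :=
  comp_mem_FP bitF_mem_FP (fanoutFn_mem_FP (comp_mem_FP fstF_mem_FP fstF_mem_FP)
    (comp_mem_FP divModFn_mem_FP (fanoutFn_mem_FP
      (comp_mem_FP (polyFn_mem_FP _) (comp_mem_FP fstF_mem_FP (comp_mem_FP fstF_mem_FP fstF_mem_FP))) sndF_mem_FP)))

/-- `cellF` answers one bit. [folklore] -/
theorem length_cellF (z : List Bool) : (cellF z).length = 1 := by
  rw [cellF, Function.comp_apply]; exact length_bitF _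

/-- Value of `cellF` on `⟨⟨⌜ψ⌝, pad⟩, 1ᵗ⟩`, `t < N²`. [cite: Valiant1979, Thm. 1] -/
theorem cellF_encode (hw : CNF.IsWidthEq 3 ψ) (pad : List Bool) (t : ℕ) (ht : t < Nsz ψ.length * Nsz ψ.length) :
    cellF (boolPair (boolPair (encodingCNF.encode ψ) pad) (ones t)) =
      [decide (b01 (mz ψ) (34 * ψ.length) (15 * ψ.length) (t / Nsz ψ.length) (t % Nsz ψ.length) = 1)] := by
  have hN : 0 < Nsz ψ.length := by
    rcases Nat.eq_zero_or_pos (Nsz ψ.length) with h | h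
    · rw [h] at ht; simp at ht
    · exact h
  have h1 : t / Nsz ψ.length < Nsz ψ.length := Nat.div_lt_of_lt_mul ht
  have h2 : t % Nsz ψ.length < Nsz ψ.length := Nat.mod_lt _ hN
  simp only [cellF, tN, Function.comp_apply, fanoutFn_apply, fstF_boolPair, sndF_boolPair, polyFn_apply,
    length_fstF_encode, eval_sizePoly, divModFn_boolPair]
  exact bitF_encode ψ hw _ _ h1 h2

/-! ### The word -/

/-- The count `bin N²` read off the context. [folklore] -/
def cntF : List Bool → List Bool := lenBinF ∘ polyFn (sizePoly * sizePoly) ∘ fstF ∘ fstF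

/-- `cntF ∈ FP`. [folklore] -/
theorem cntF_mem_FP : cntF ∈ FP :=
  comp_mem_FP lenBinF_mem_FP (comp_mem_FP (polyFn_mem_FP _) (comp_mem_FP fstF_mem_FP fstF_mem_FP))

/-- **The word function**: the concatenation of the `N²` cells over the context. [cite: Valiant1979, Thm. 1] -/
def wordF : List Bool → List Bool := cmapF cntF cellF 1 ∘ mkCtx

/-- `wordF ∈ FP`. [cite: Valiant1979, Thm. 1] -/
theorem wordF_mem_FP : wordF ∈ FP := comp_mem_FP (cmapF_mem_FP 1 cntF_mem_FP cellF_mem_FP) mkCtx_mem_FP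

/-- `m ≤ |⌜ψ⌝|`. [folklore] -/
theorem length_le_length_encode : ψ.length ≤ (encodingCNF.encode ψ).length := by
  rw [encode_eq, length_boolPair, length_ones]; omega

/-- **Value of the word function** on the code of a 3-CNF. [cite: Valiant1979, Thm. 1] -/
theorem wordF_encode (hw : CNF.IsWidthEq 3 ψ) : wordF (encodingCNF.encode ψ) = word ψ := by
  rw [wordF, Function.comp_apply, mkCtx_apply]
  have hcnt : cntF (boolPair (encodingCNF.encode ψ) (ones (Nsz (encodingCNF.encode ψ).length *
      Nsz (encodingCNF.encode ψ).length))) = encodeNat (Nsz ψ.length * Nsz ψ.length) := by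
    simp [cntF, length_fstF_encode]
  have hle : Nsz ψ.length * Nsz ψ.length ≤ Nsz (encodingCNF.encode ψ).length * Nsz (encodingCNF.encode ψ).length :=
    Nat.mul_le_mul (Nsz_mono (length_le_length_encode ψ)) (Nsz_mono (length_le_length_encode ψ))
  rw [cmapF_apply hcnt (by rw [length_boolPair, length_ones]; omega)
    (fun j _ => by rw [length_cellF]; omega)]
  exact ccat_congr fun t ht => cellF_encode ψ hw _ t ht

/-! ### The reduction function -/

/-- "Every clause has exactly three literals", on a CNF code (`SharpSATVerif.hdrEqFn` on every item). [cite: LiskiewiczOgiharaToda2003, §2.3] -/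
def w3F : List Bool → List Bool := allFn (hdrEqFn [true, true, true])

/-- `w3F ∈ FP`. [folklore] -/
theorem w3F_mem_FP : w3F ∈ FP := allFn_mem_FP (hdrEqFn_mem_FP _) (oneBit_hdrEqFn _)

/-- **Value of `w3F`** on the code of a CNF: `[IsWidthEq 3 φ]`. [cite: LiskiewiczOgiharaToda2003, §2.3] -/
theorem w3F_encode (φ : CNF ℕ) : w3F (encodingCNF.encode φ) = [decide (CNF.IsWidthEq 3 φ)] := by
  have h := width3Fn_eq_true_iff φ []
  rw [width3Fn, Function.comp_apply, fstF_boolPair] at h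
  change w3F (encodingCNF.encode φ) = [true] ↔ CNF.IsWidthEq 3 φ at h
  obtain ⟨b, hb⟩ := oneBit_allFn (oneBit_hdrEqFn [true, true, true]) (encodingCNF.encode φ)
  change w3F (encodingCNF.encode φ) = [b] at hb
  rw [hb] at h ⊢
  refine bit_congr ?_
  rw [← h]
  simp

/-- **Valiant's reduction function** (word format): canonicalise, test width `3`, write the word
of the `0/1` matrix; invalid inputs go to the non-square word `00`. [cite: Valiant1979, Thm. 1] -/
def redF : List Bool → List Bool := iteB (w3F ∘ canonCNFFn) (wordF ∘ canonCNFFn) (cst [false, false])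

/-- **`redF ∈ FP`.** [cite: Valiant1979, Thm. 1] -/
theorem redF_mem_FP : redF ∈ FP :=
  iteB_mem_FP (comp_mem_FP w3F_mem_FP canonCNFFn_mem_FP) (comp_mem_FP wordF_mem_FP canonCNFFn_mem_FP) (cst_mem_FP _)

/-- **Value of the reduction function.** [cite: Valiant1979, Thm. 1] -/
theorem redF_apply (w : List Bool) :
    redF w = if CNF.IsWidthEq 3 (NegCNF.decCNF w) then word (NegCNF.decCNF w) else [false, false] := by
  simp only [redF, iteB_apply, Function.comp_apply, canonCNFFn_eq, w3F_encode, List.headD_cons, decide_eq_true_eq,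
    cst_apply]
  split_ifs with h
  · exact wordF_encode _ h
  · rfl

/-! ### The post-processing -/

/-- The arithmetic `⟨x₀, a⟩ ↦ bin ((val a mod (2^{15m} + 1)) / 2^{12m})`, `1ᵐ = fstF x₀`. [cite: Valiant1979, Prop. 3.4] -/
def arithF : List Bool → List Bool :=
  divFn ∘ fanoutFn
    (remFn ∘ fanoutFn sndF (addFn ∘ fanoutFn (pow2NumFn (15 * X) ∘ fstF ∘ fstF) (cst [true])))
    (pow2NumFn (12 * X) ∘ fstF ∘ fstF)

/-- `arithF ∈ FP`. [folklore] -/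
theorem arithF_mem_FP : arithF ∈ FP :=
  comp_mem_FP divFn_mem_FP (fanoutFn_mem_FP
    (comp_mem_FP remFn_mem_FP (fanoutFn_mem_FP sndF_mem_FP (comp_mem_FP addFn_mem_FP
      (fanoutFn_mem_FP (comp_mem_FP (pow2NumFn_mem_FP _) (comp_mem_FP fstF_mem_FP fstF_mem_FP)) (cst_mem_FP _)))))
    (comp_mem_FP (pow2NumFn_mem_FP _) (comp_mem_FP fstF_mem_FP fstF_mem_FP)))

/-- Value of `arithF` on `⟨⌜ψ⌝, a⟩`. [cite: Valiant1979, Prop. 3.4] -/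
theorem arithF_apply (a : List Bool) :
    arithF (boolPair (encodingCNF.encode ψ) a) =
      encodeNat (bitsToNat a % (2 ^ (15 * ψ.length) + 1) / 2 ^ (12 * ψ.length)) := by
  simp only [arithF, Function.comp_apply, fanoutFn_apply, sndF_boolPair, fstF_boolPair, cst_apply, addFn_boolPair,
    bitsToNat_pow2NumFn, length_fstF_encode, eval_mul, eval_ofNat, eval_X, remFn_boolPair, bitsToNat_encodeNat,
    divFn_boolPair]
  rfl

/-- **The post-processing** `⟨x₀, a⟩ ↦ bin ((val a mod (2^{15m}+1)) / 2^{12m})` on codes of 3-CNFs,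
`ε = bin 0` otherwise. [cite: Valiant1979, Thm. 1] -/
def postF : List Bool → List Bool := iteB (w3F ∘ fstF) arithF (cst [])

/-- **`postF ∈ FP`.** [folklore] -/
theorem postF_mem_FP : postF ∈ FP := iteB_mem_FP (comp_mem_FP w3F_mem_FP fstF_mem_FP) arithF_mem_FP (cst_mem_FP _)

/-- **Value of the post-processing** on `⟨⌜ψ⌝, bin P⟩`. [cite: Valiant1979, Thm. 1] -/
theorem postF_apply (P : ℕ) :
    postF (boolPair (encodingCNF.encode ψ) (encodeNat P)) =
      encodeNat (if CNF.IsWidthEq 3 ψ then P % (2 ^ (15 * ψ.length) + 1) / 2 ^ (12 * ψ.length) else 0) := by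
  simp only [postF, iteB_apply, Function.comp_apply, fstF_boolPair, w3F_encode, List.headD_cons, decide_eq_true_eq,
    cst_apply]
  split_ifs with h
  · rw [arithF_apply, bitsToNat_encodeNat]
  · rfl

end ValiantFP

end Literature.Computability.AlgebraicComplexity
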